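import Literature.Claims.NS.Siche2026
import HarnessLib

/-!
# C135 `Siche2026` — solo refutation of Step 6 (Proposition 7.2 (59) p. 24), face (B): the field block

Part 1 of 2 of the face-(B) kit (ns-claims-typist-10 g3; skeleton `Literature/Claims/NS/Siche2026.lean`
p500157, typist-3 g4). The WITNESS FAMILY for `¬ Step6_vorticityBound` (proved in part 2,
`SoloRefuteSiche2026Step6.lean`): the weighted aligned lacunary parallel shear polynomials on the unit torus
`u(x) = Σ_{a=1}^{M} c · r(±2^a e₁) · 2^{-a} sin(2π 2^a x₁) e₀ = realTrigPoly (lacFreq M) (coeffW c r)`,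
wave vectors `±2^a e₁`, coefficients `(r_k : ℂ) • (−ic/(2k₁)) e₀` (a general real weight `r` on the
frequencies is carried so that the block applies verbatim to the heat-flow evolution `r_k = e^{−4π²ν|k|²t}` of the
datum; the kill uses `r ≡ 1`). Proved here, all from the tree's torus calculus (`TorusTrigPoly`,
`TorusFourierCalculus`): smooth, divergence-free, `E = (c²/8) Σ_a (r₊² + r₋²) 4^{-a} ≤ c²/12` for `r² ≤ 1`,
`‖∇u‖²_{L²} = π²c² Σ_a (r₊² + r₋²)` (`= 2π²c²M` at `r ≡ 1`), every entry of `∇u` except `(∂₁u)₀` vanishes, and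
`(∂₁u(0))₀ = πc Σ_a (r₊ + r₋)` (`= 2πcM` at `r ≡ 1`). Nothing about C135 is asserted in this file.
-/

noncomputable section

-- cell convention (SoloRefute files): the Theorems namespace repeats `NavierStokesRegularity`.
set_option linter.dupNamespace false

open MeasureTheory Finset UnitAddTorus
open Literature.Analysis Literature.Analysis.FluidPDE Literature.Analysis.FunctionSpaces
open Literature.Analysis.FunctionSpaces.Torus
open Literature.Claims.NS.Siche2026

namespace Summit.NavierStokesRegularity.NavierStokesRegularity.Theorems.Siche2026

/-! ## 1. The lacunary frequency set `{±2^a e₁ : 1 ≤ a ≤ M}` -/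

/-- The lattice vector `n e₁`. [folklore] -/
def ax (n : ℤ) : Z3 := Pi.single 1 n

/-- Component `1` of `n e₁` is `n`. [folklore] -/
@[simp] theorem ax_apply_one (n : ℤ) : ax n 1 = n := by simp [ax]
/-- Component `0` of `n e₁` vanishes. [folklore] -/
@[simp] theorem ax_apply_zero (n : ℤ) : ax n 0 = 0 := by simp [ax]
/-- Component `2` of `n e₁` vanishes. [folklore] -/
@[simp] theorem ax_apply_two (n : ℤ) : ax n 2 = 0 := by simp [ax]

/-- `−(n e₁) = (−n) e₁`. [folklore] -/
theorem neg_ax (n : ℤ) : -ax n = ax (-n) := by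
  ext i; fin_cases i <;> simp [ax]

/-- `n ↦ n e₁` is injective. [folklore] -/
theorem ax_injective : Function.Injective ax := fun a b h => by
  have := congrFun h 1; simpa using this

/-- `a ↦ 2^a` is injective on `ℕ` (as integers). [folklore] -/
theorem pow_inj : Function.Injective (fun a : ℕ => (2 : ℤ) ^ a) := by
  intro a b h
  have h' : (2 : ℤ) ^ a = (2 : ℤ) ^ b := h
  have h'' : (2 : ℕ) ^ a = (2 : ℕ) ^ b := by exact_mod_cast h'
  exact Nat.pow_right_injective (le_refl 2) h''

/-- The lacunary frequency set `{±2^a e₁ : 1 ≤ a ≤ M}`. [folklore] -/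
def lacFreq (M : ℕ) : Finset Z3 :=
  (Icc 1 M).image (fun a => ax (2 ^ a)) ∪ (Icc 1 M).image (fun a => ax (-(2 ^ a)))

/-- The two branches `{2^a e₁}` and `{−2^a e₁}` are disjoint. [folklore] -/
theorem disjoint_lac (M : ℕ) :
    Disjoint ((Icc 1 M).image (fun a => ax (2 ^ a))) ((Icc 1 M).image (fun a => ax (-(2 ^ a)))) := by
  rw [Finset.disjoint_left]
  intro k hk hk'
  simp only [mem_image] at hk hk'
  obtain ⟨a, -, rfl⟩ := hk
  obtain ⟨b, -, h⟩ := hk'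
  have := congrFun h 1
  simp only [ax_apply_one] at this
  have h1 : (0 : ℤ) < 2 ^ a := by positivity
  have h2 : (0 : ℤ) < 2 ^ b := by positivity
  linarith

/-- Membership in the lacunary set. [folklore] -/
theorem mem_lacFreq {M : ℕ} {k : Z3} :
    k ∈ lacFreq M ↔ ∃ a ∈ Icc 1 M, k = ax (2 ^ a) ∨ k = ax (-(2 ^ a)) := by
  simp only [lacFreq, mem_union, mem_image]
  constructor
  · rintro (⟨a, ha, rfl⟩ | ⟨a, ha, rfl⟩)
    · exact ⟨a, ha, Or.inl rfl⟩
    · exact ⟨a, ha, Or.inr rfl⟩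
  · rintro ⟨a, ha, rfl | rfl⟩
    · exact Or.inl ⟨a, ha, rfl⟩
    · exact Or.inr ⟨a, ha, rfl⟩

/-- The lacunary set is symmetric under `k ↦ −k`. [folklore] -/
theorem neg_mem_lacFreq (M : ℕ) : ∀ k ∈ lacFreq M, -k ∈ lacFreq M := by
  intro k hk
  rw [mem_lacFreq] at hk ⊢
  obtain ⟨a, ha, rfl | rfl⟩ := hk
  · exact ⟨a, ha, Or.inr (by rw [neg_ax])⟩
  · exact ⟨a, ha, Or.inl (by rw [neg_ax, neg_neg])⟩

/-- Lacunary frequencies have `k₁ ≠ 0`. [folklore] -/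
theorem apply_one_ne_zero {M : ℕ} {k : Z3} (hk : k ∈ lacFreq M) : k 1 ≠ 0 := by
  rw [mem_lacFreq] at hk
  obtain ⟨a, -, rfl | rfl⟩ := hk <;> simp

/-- Lacunary frequencies have `k₀ = 0`. [folklore] -/
theorem apply_zero_eq_zero {M : ℕ} {k : Z3} (hk : k ∈ lacFreq M) : k 0 = 0 := by
  rw [mem_lacFreq] at hk
  obtain ⟨a, -, rfl | rfl⟩ := hk <;> simp

/-- Lacunary frequencies have `k₂ = 0`. [folklore] -/
theorem apply_two_eq_zero {M : ℕ} {k : Z3} (hk : k ∈ lacFreq M) : k 2 = 0 := by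
  rw [mem_lacFreq] at hk
  obtain ⟨a, -, rfl | rfl⟩ := hk <;> simp

/-- Sums over the lacunary set split into the two branches. [folklore] -/
theorem sum_lacFreq {β : Type*} [AddCommMonoid β] (M : ℕ) (g : Z3 → β) :
    ∑ k ∈ lacFreq M, g k = ∑ a ∈ Icc 1 M, g (ax (2 ^ a)) + ∑ a ∈ Icc 1 M, g (ax (-(2 ^ a))) := by
  rw [lacFreq, sum_union (disjoint_lac M), sum_image, sum_image]
  · intro a _ b _ h
    exact pow_inj (neg_injective (ax_injective h))
  · intro a _ b _ h
    exact pow_inj (ax_injective h)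

/-! ## 2. The weighted coefficients -/

/-- The unit vector `e₀ ∈ ℂ³`. [folklore] -/
def e0 : EuclideanSpace ℂ (Fin 3) := EuclideanSpace.single 0 1

/-- The unweighted coefficients `c_k = (−i c / (2 k₁)) e₀`. [folklore] -/
def lacCoeff (c : ℝ) (k : Z3) : EuclideanSpace ℂ (Fin 3) :=
  (-(Complex.I * c) / (2 * (k 1 : ℂ))) • e0

/-- The weighted coefficients `(r k : ℂ) • c_k` (real weight `r`; `r = e^{−λ_k t}` for the heat flow). [folklore] -/
def coeffW (c : ℝ) (r : Z3 → ℝ) (k : Z3) : EuclideanSpace ℂ (Fin 3) :=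
  ((r k : ℝ) : ℂ) • lacCoeff c k

/-- Components of the unweighted coefficients. [folklore] -/
theorem lacCoeff_apply (c : ℝ) (k : Z3) (i : Fin 3) :
    lacCoeff c k i = (-(Complex.I * c) / (2 * (k 1 : ℂ))) * (if i = 0 then 1 else 0) := by
  simp [lacCoeff, e0]

/-- Components of the weighted coefficients. [folklore] -/
theorem coeffW_apply (c : ℝ) (r : Z3 → ℝ) (k : Z3) (i : Fin 3) :
    coeffW c r k i = (r k : ℂ) * ((-(Complex.I * c) / (2 * (k 1 : ℂ))) * (if i = 0 then 1 else 0)) := by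
  rw [coeffW, PiLp.smul_apply, smul_eq_mul, lacCoeff_apply]

/-- The weighted coefficients are conjugate-symmetric for an even weight (reality of the field). [folklore] -/
theorem isConjSymm_coeffW (c : ℝ) {r : Z3 → ℝ} (hr : ∀ k, r (-k) = r k) : IsConjSymm (coeffW c r) := by
  intro k
  ext i
  rw [EuclideanSpace.conjVec_apply, coeffW_apply, coeffW_apply, hr]
  simp only [Pi.neg_apply, Int.cast_neg, map_mul, map_div₀, map_neg, Complex.conj_I,
    Complex.conj_ofReal, map_ofNat]
  split_ifs <;> simp

/-- The weighted coefficients are transversal, `k · c_k = 0` (divergence-freeness). [folklore] -/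
theorem isTransversal_coeffW (M : ℕ) (c : ℝ) (r : Z3 → ℝ) : IsTransversal (lacFreq M) (coeffW c r) := by
  intro k hk
  simp only [Fin.sum_univ_three, coeffW_apply]
  simp [apply_zero_eq_zero hk]

/-- The cross-transversality refuter-7 g2's heat-flow core consumes: `l · c_k = 0` for all `k, l` in the
lacunary set (wavevectors along `e₁`, coefficients along `e₀`). [folklore] -/
theorem cross_coeffW (M : ℕ) (c : ℝ) (r : Z3 → ℝ) :
    ∀ k ∈ lacFreq M, ∀ l ∈ lacFreq M, ∑ j, (l j : ℂ) * coeffW c r k j = 0 := by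
  intro k _ l hl
  simp only [Fin.sum_univ_three, coeffW_apply]
  simp [apply_zero_eq_zero hl]

/-- `‖c_k‖² = c²/(4k₁²)`. [folklore] -/
theorem norm_sq_lacCoeff (c : ℝ) (k : Z3) :
    ‖lacCoeff c k‖ ^ 2 = c ^ 2 / (4 * (k 1 : ℝ) ^ 2) := by
  rw [lacCoeff, norm_smul]
  have he : ‖e0‖ = 1 := by simp [e0]
  rw [he, mul_one]
  rw [norm_div, norm_neg, norm_mul, Complex.norm_I, one_mul, Complex.norm_real, norm_mul,
    Complex.norm_ofNat, Complex.norm_intCast, Real.norm_eq_abs, div_pow, mul_pow, sq_abs, sq_abs]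
  norm_num

/-- `‖r_k c_k‖² = r_k² c²/(4k₁²)`. [folklore] -/
theorem norm_sq_coeffW (c : ℝ) (r : Z3 → ℝ) (k : Z3) :
    ‖coeffW c r k‖ ^ 2 = r k ^ 2 * (c ^ 2 / (4 * (k 1 : ℝ) ^ 2)) := by
  rw [coeffW, norm_smul, mul_pow, Complex.norm_real, Real.norm_eq_abs, sq_abs, norm_sq_lacCoeff]

/-! ## 3. The weighted field -/

/-- The weighted aligned lacunary parallel shear field. [folklore] -/
def shearW (M : ℕ) (c : ℝ) (r : Z3 → ℝ) : UnitAddTorus (Fin 3) → EuclideanSpace ℝ (Fin 3) :=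
  realTrigPoly (lacFreq M) (coeffW c r)

/-- The weighted shear field is smooth (a trigonometric polynomial). [folklore] -/
theorem isSmooth_shearW (M : ℕ) (c : ℝ) (r : Z3 → ℝ) : IsSmooth (shearW M c r) :=
  isSmooth_realTrigPoly _ _

/-- The weighted shear field is divergence-free. [folklore] -/
theorem isDivFree_shearW (M : ℕ) (c : ℝ) (r : Z3 → ℝ) : IsDivFree (shearW M c r) :=
  isDivFree_realTrigPoly (isTransversal_coeffW M c r)

/-- `Σ_{a=1}^M 4^{-a} ≤ 1/3`. [folklore] -/
theorem sum_quarter_pow_le (M : ℕ) : ∑ a ∈ Icc 1 M, ((4 : ℝ) ^ a)⁻¹ ≤ 1 / 3 := by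
  suffices h : ∑ a ∈ Icc 1 M, ((4 : ℝ) ^ a)⁻¹ = 1 / 3 * (1 - ((4 : ℝ) ^ M)⁻¹) by
    rw [h]
    have : 0 < ((4 : ℝ) ^ M)⁻¹ := by positivity
    nlinarith
  induction M with
  | zero => simp
  | succ n ih =>
    rw [Finset.sum_Icc_succ_top (by omega), ih, pow_succ, mul_inv]
    ring

/-- `(2^a)² = 4^a` in `ℝ`. [folklore] -/
theorem two_pow_sq (a : ℕ) : ((2 : ℝ) ^ a) ^ 2 = 4 ^ a := by
  rw [← pow_mul, mul_comm, pow_mul]; norm_num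

/-- **Energy**: `E = (c²/8) Σ_a (r(2^a e₁)² + r(−2^a e₁)²) 4^{-a}`. [folklore] -/
theorem kineticEnergy_shearW (M : ℕ) (c : ℝ) {r : Z3 → ℝ} (hr : ∀ k, r (-k) = r k) :
    kineticEnergy (shearW M c r) =
      c ^ 2 / 8 * ∑ a ∈ Icc 1 M, (r (ax (2 ^ a)) ^ 2 + r (ax (-(2 ^ a))) ^ 2) * ((4 : ℝ) ^ a)⁻¹ := by
  rw [shearW, kineticEnergy_realTrigPoly (neg_mem_lacFreq M) (isConjSymm_coeffW c hr), sum_lacFreq]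
  simp_rw [norm_sq_coeffW]
  simp only [ax_apply_one, Int.cast_pow, Int.cast_ofNat, Int.cast_neg, neg_sq, two_pow_sq]
  rw [← Finset.sum_add_distrib, Finset.mul_sum, Finset.mul_sum]
  refine Finset.sum_congr rfl fun a _ => ?_
  have : (4 : ℝ) ^ a ≠ 0 := by positivity
  field_simp
  ring

/-- Energy bound for weights in `[−1, 1]`: `E ≤ c²/12`. [folklore] -/
theorem kineticEnergy_shearW_le (M : ℕ) (c : ℝ) {r : Z3 → ℝ} (hr : ∀ k, r (-k) = r k)
    (hr1 : ∀ k, r k ^ 2 ≤ 1) : kineticEnergy (shearW M c r) ≤ c ^ 2 / 12 := by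
  rw [kineticEnergy_shearW M c hr]
  have hsum : ∑ a ∈ Icc 1 M, (r (ax (2 ^ a)) ^ 2 + r (ax (-(2 ^ a))) ^ 2) * ((4 : ℝ) ^ a)⁻¹ ≤
      ∑ a ∈ Icc 1 M, 2 * ((4 : ℝ) ^ a)⁻¹ := by
    refine sum_le_sum fun a _ => ?_
    have h4 : 0 ≤ ((4 : ℝ) ^ a)⁻¹ := by positivity
    nlinarith [hr1 (ax (2 ^ a)), hr1 (ax (-(2 ^ a)))]
  rw [← mul_sum] at hsum
  have := sum_quarter_pow_le M
  have hc : 0 ≤ c ^ 2 / 8 := by positivity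
  nlinarith

/-- **Spectral gradient norm**: `‖∇u‖² = π²c² Σ_a (r(2^a e₁)² + r(−2^a e₁)²)`. [folklore] -/
theorem eGradNormSq_shearW (M : ℕ) (c : ℝ) {r : Z3 → ℝ} (hr : ∀ k, r (-k) = r k) :
    (eGradNormSq (shearW M c r)).toReal =
      Real.pi ^ 2 * c ^ 2 * ∑ a ∈ Icc 1 M, (r (ax (2 ^ a)) ^ 2 + r (ax (-(2 ^ a))) ^ 2) := by
  rw [shearW, toReal_eGradNormSq_realTrigPoly (neg_mem_lacFreq M) (isConjSymm_coeffW c hr), sum_lacFreq]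
  have hf : ∀ n : ℤ, n ≠ 0 → freqNormSq (ax n) * ‖coeffW c r (ax n)‖ ^ 2 = r (ax n) ^ 2 * (c ^ 2 / 4) := by
    intro n hn
    rw [norm_sq_coeffW, freqNormSq, Fin.sum_univ_three]
    simp only [ax_apply_zero, ax_apply_one, ax_apply_two, Int.cast_zero]
    have : (n : ℝ) ≠ 0 := by exact_mod_cast hn
    field_simp
    ring
  have h1 : ∀ a ∈ Icc 1 M, freqNormSq (ax (2 ^ a)) * ‖coeffW c r (ax (2 ^ a))‖ ^ 2 =
      r (ax (2 ^ a)) ^ 2 * (c ^ 2 / 4) := fun a _ => hf _ (by positivity)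
  have h2 : ∀ a ∈ Icc 1 M, freqNormSq (ax (-(2 ^ a))) * ‖coeffW c r (ax (-(2 ^ a)))‖ ^ 2 =
      r (ax (-(2 ^ a))) ^ 2 * (c ^ 2 / 4) := fun a _ => hf _ (neg_ne_zero.mpr (by positivity))
  rw [sum_congr rfl h1, sum_congr rfl h2, ← Finset.sum_add_distrib, Finset.mul_sum, Finset.mul_sum]
  refine Finset.sum_congr rfl fun a _ => ?_
  ring

/-- **Derivative-based gradient norm** `‖∇u‖²_{L²} = π²c² Σ_a (r(2^a e₁)² + r(−2^a e₁)²)` (the tree's bridge `gradNormSq = eGradNormSq.toReal` for smooth fields). [folklore] -/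
theorem gradNormSq_shearW (M : ℕ) (c : ℝ) {r : Z3 → ℝ} (hr : ∀ k, r (-k) = r k) :
    gradNormSq (shearW M c r) =
      Real.pi ^ 2 * c ^ 2 * ∑ a ∈ Icc 1 M, (r (ax (2 ^ a)) ^ 2 + r (ax (-(2 ^ a))) ^ 2) := by
  rw [gradNormSq_eq_toReal_eGradNormSq_holds (isSmooth_shearW M c r), eGradNormSq_shearW M c hr]

/-- Gradient-norm bound for weights in `[−1, 1]`: `‖∇u‖² ≤ 2π²c²M`. [folklore] -/
theorem gradNormSq_shearW_le (M : ℕ) (c : ℝ) {r : Z3 → ℝ} (hr : ∀ k, r (-k) = r k)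
    (hr1 : ∀ k, r k ^ 2 ≤ 1) : gradNormSq (shearW M c r) ≤ 2 * Real.pi ^ 2 * c ^ 2 * M := by
  rw [gradNormSq_shearW M c hr]
  have hsum : ∑ a ∈ Icc 1 M, (r (ax (2 ^ a)) ^ 2 + r (ax (-(2 ^ a))) ^ 2) ≤ ∑ a ∈ Icc 1 M, (2 : ℝ) :=
    sum_le_sum fun a _ => by nlinarith [hr1 (ax (2 ^ a)), hr1 (ax (-(2 ^ a)))]
  rw [sum_const, Nat.card_Icc, nsmul_eq_mul] at hsum
  have hc : 0 ≤ Real.pi ^ 2 * c ^ 2 := by positivity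
  calc Real.pi ^ 2 * c ^ 2 * ∑ a ∈ Icc 1 M, (r (ax (2 ^ a)) ^ 2 + r (ax (-(2 ^ a))) ^ 2)
      ≤ Real.pi ^ 2 * c ^ 2 * ((M + 1 - 1 : ℕ) * 2) := mul_le_mul_of_nonneg_left hsum hc
    _ = 2 * Real.pi ^ 2 * c ^ 2 * M := by
      rw [show (M + 1 - 1 : ℕ) = M by omega]; ring

/-! ## 4. Components and derivatives -/

/-- The characters equal `1` at the origin. [folklore] -/
theorem mFourier_apply_origin (k : Z3) : mFourier k (0 : UnitAddTorus (Fin 3)) = 1 := by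
  simp [mFourier]

/-- Components of the vector partial derivatives: `(∂ᵢu(x))ⱼ = Re Σ_k e_k(x) (2πi kᵢ) (c_k)ⱼ`. [folklore] -/
theorem partialDeriv_shearW_apply (M : ℕ) (c : ℝ) (r : Z3 → ℝ) (i j : Fin 3) (x : UnitAddTorus (Fin 3)) :
    partialDeriv i (shearW M c r) x j =
      (∑ k ∈ lacFreq M, mFourier k x * ((2 * Real.pi * Complex.I * (k i : ℂ)) * coeffW c r k j)).re := by
  rw [shearW, partialDeriv_realTrigPoly, realTrigPoly_apply_coord, trigPoly_apply_coord]
  rfl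

/-- Components `1, 2` of every partial derivative vanish (the field points along `e₀`). [folklore] -/
theorem partialDeriv_shearW_apply_of_ne (M : ℕ) (c : ℝ) (r : Z3 → ℝ) (i : Fin 3) {j : Fin 3} (hj : j ≠ 0)
    (x : UnitAddTorus (Fin 3)) : partialDeriv i (shearW M c r) x j = 0 := by
  rw [partialDeriv_shearW_apply, sum_eq_zero fun k _ => by rw [coeffW_apply, if_neg hj]; ring]
  simp

/-- The partial derivatives along `e₀` and `e₂` vanish componentwise (the field depends on `x₁` only). [folklore] -/
theorem partialDeriv_shearW_apply_of_dir (M : ℕ) (c : ℝ) (r : Z3 → ℝ) {i : Fin 3} (hi : i ≠ 1) (j : Fin 3)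
    (x : UnitAddTorus (Fin 3)) : partialDeriv i (shearW M c r) x j = 0 := by
  rw [partialDeriv_shearW_apply, sum_eq_zero fun k hk => ?_]
  · simp
  · have : (k i : ℂ) = 0 := by
      fin_cases i
      · exact_mod_cast apply_zero_eq_zero hk
      · exact absurd rfl hi
      · exact_mod_cast apply_two_eq_zero hk
    rw [this]; ring

/-- **The shear gradient at the origin**: `(∂₁u(0))₀ = πc Σ_{k∈S} r k = πc Σ_a (r(2^a e₁) + r(−2^a e₁))`. [folklore] -/
theorem partialDeriv_one_shearW_origin (M : ℕ) (c : ℝ) (r : Z3 → ℝ) :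
    partialDeriv 1 (shearW M c r) 0 0 =
      Real.pi * c * ∑ a ∈ Icc 1 M, (r (ax (2 ^ a)) + r (ax (-(2 ^ a)))) := by
  rw [partialDeriv_shearW_apply]
  simp_rw [mFourier_apply_origin, one_mul]
  have hterm : ∀ k ∈ lacFreq M,
      (2 * Real.pi * Complex.I * (k 1 : ℂ)) * coeffW c r k 0 = ((Real.pi * c * r k : ℝ) : ℂ) := by
    intro k hk
    have hk1 : (k 1 : ℂ) ≠ 0 := by exact_mod_cast apply_one_ne_zero hk
    rw [coeffW_apply, if_pos rfl]
    field_simp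
    push_cast
    ring_nf
    rw [Complex.I_sq]
    ring
  rw [sum_congr rfl hterm, ← Complex.ofReal_sum, Complex.ofReal_re, sum_lacFreq, ← Finset.sum_add_distrib,
    Finset.mul_sum]
  refine sum_congr rfl fun a _ => ?_
  ring

/-- Unweighted datum (`r ≡ 1`): `(∂₁u(0))₀ = 2π c M`. [folklore] -/
theorem partialDeriv_one_shearW_origin_one (M : ℕ) (c : ℝ) :
    partialDeriv 1 (shearW M c fun _ => 1) 0 0 = 2 * Real.pi * c * M := by
  rw [partialDeriv_one_shearW_origin]
  simp only [sum_const, Nat.card_Icc, show (M + 1 - 1 : ℕ) = M by omega, nsmul_eq_mul]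
  ring

/-- Unweighted datum: `‖∇u‖² = 2π²c²M`. [folklore] -/
theorem gradNormSq_shearW_one (M : ℕ) (c : ℝ) :
    gradNormSq (shearW M c fun _ => 1) = 2 * Real.pi ^ 2 * c ^ 2 * M := by
  rw [gradNormSq_shearW M c fun _ => rfl]
  simp only [one_pow, sum_const, Nat.card_Icc, show (M + 1 - 1 : ℕ) = M by omega, nsmul_eq_mul]
  ring

end Summit.NavierStokesRegularity.NavierStokesRegularity.Theorems.Siche2026

end
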